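import Summits.NavierStokesRegularity.NavierStokesRegularity.Theorems.CertifiedBlowupCertifiedBlowupAxisymBlowupStubStabilityOfStepTools

/-! # Continuous dependence on the datum in `H¹` for Tao's class, by time-stepping —
crux stmt-NavierStokesRegularity-0727 (`CertifiedBlowup.CertifiedBlowupAxisymBlowup`), line
`compact-amplification`, stub `stub_stability_of_step`

PROVED, exactly as registered: GIVEN the one-step `H¹` recovery (hypothesis `STEP`: a data bound
`A` fixes a step `σ > 0`, an enstrophy bound `S` on slabs `[0, T]`, `T ≤ σ`, and an `H²` bound
`H` at the end of a full step) and the interpolation (hypothesis `INTERP`: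
`(∫|∇f|²)² ≤ K ∫‖f‖² ∫‖D²f‖²`), every Tao-class solution `u` on `[0, T]` admits `δ > 0` and `B`
such that every Tao-class solution `v` on a sub-slab `[0, T'] ⊆ [0, T]` from a datum `δ`-close to
`u₀` in `H¹` has `∫‖∇v(t)‖² ≤ B` on `[0, T']`.

**Proof.** Let `Cₙ ≥ sup_{[0,T]} ∫‖Dⁿu‖²` (`n = 0, 1, 2`), `A = 4(C₀ + 3C₁) + 8`, and `σ, S, H`
from `STEP`. The tree's `L²` stability of the difference of two solutions in the class
(`Literature.Analysis.FluidPDE.exists_l2_stability`, Robinson–Rodrigo–Sadowski 2016, Thm. 6.10)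
gives `∫‖v(τ) − u(τ)‖² ≤ δ M₁`, `M₁ = exp(C ν⁻³ (3C₁)² T)`, on `[0, T']`. Induction over the
restart times `iσ ≤ T'` on the data bound `∫‖v(iσ)‖² + ∫|∇v(iσ)|² ≤ A`: at `i = 0` it holds by
`δ ≤ 1`; given it at `iσ`, `STEP` applied to the restarted solution
(`IsTaoSolutionOn.translate`, `.mono`) bounds `∫‖D²v((i+1)σ)‖² ≤ H`, so `INTERP` for
`d = v((i+1)σ) − u((i+1)σ)` gives `(∫|∇d|²)² ≤ K δM₁ (2H⁺ + 2C₂) ≤ 1` by the choice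
`δ = min 1 (1/((K+1) M₁ (2H⁺ + 2C₂ + 1)))`; hence `∫|∇v((i+1)σ)|² ≤ 6C₁ + 2`, and the energy
inequality (`IsTaoSolutionOn.lintegral_enorm_sq_le`) gives `∫‖v((i+1)σ)‖² ≤ 2C₀ + 2`: the data
bound `A` is recovered. Finally, for `t ∈ [0, T']` restart at `iσ = ⌊t/σ⌋σ ≤ t` (`STEP` on the
slab of length `min σ (T' − iσ)`): `∫‖∇v(t)‖² ≤ ∫|∇v(t)|² ≤ max S A =: B`.
Generic lemmas: `CertifiedBlowupCertifiedBlowupAxisymBlowupStubStabilityOfStepTools`.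
-/

set_option linter.dupNamespace false

noncomputable section

open MeasureTheory Set Function Filter Topology
open scoped ENNReal NNReal ContDiff

namespace Summit.NavierStokesRegularity.NavierStokesRegularity.Theorems.CertifiedBlowupAxisymBlowup.CompactAmplification

open Literature.Analysis.FluidPDE

local notation "ℝ³" => EuclideanSpace ℝ (Fin 3)

/-! ### The initial data bound -/

/-- **The data bound at time `0`.** If `∫‖u₀‖² ≤ C₀`, `∫‖Du₀‖² ≤ C₁` and `v₀` is `δ`-close to
`u₀` in `H¹` with `δ ≤ 1`, then `∫‖v₀‖² ≤ 2C₀ + 2` and `∫|∇v₀|² ≤ 6C₁ + 6`. -/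
theorem stab_init {C₀ C₁ δ : ℝ} {v₀ u₀ : ℝ³ → ℝ³} (hu₀ : Continuous u₀)
    (hDu₀ : Continuous (fderiv ℝ u₀)) (h0 : ∫⁻ x, ‖u₀ x‖ₑ ^ 2 ≤ ENNReal.ofReal C₀)
    (h1 : ∫⁻ x, ‖fderiv ℝ u₀ x‖ₑ ^ 2 ≤ ENNReal.ofReal C₁) (hC₀ : 0 ≤ C₀) (hC₁ : 0 ≤ C₁)
    (hδ1 : δ ≤ 1)
    (hclose : (∫⁻ x, ‖v₀ x - u₀ x‖ₑ ^ 2) + (∫⁻ x, ‖fderiv ℝ v₀ x - fderiv ℝ u₀ x‖ₑ ^ 2) ≤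
      ENNReal.ofReal δ) :
    (∫⁻ x, ‖v₀ x‖ₑ ^ 2) ≤ ENNReal.ofReal (2 * C₀ + 2) ∧
      (∫⁻ x, ENNReal.ofReal (frobeniusNormSq (fderiv ℝ v₀ x))) ≤
        ENNReal.ofReal (6 * C₁ + 6) := by
  have hA : ∫⁻ x, ‖v₀ x - u₀ x‖ₑ ^ 2 ≤ ENNReal.ofReal 1 :=
    (le_self_add.trans hclose).trans (ENNReal.ofReal_le_ofReal hδ1)
  have hB : ∫⁻ x, ‖fderiv ℝ v₀ x - fderiv ℝ u₀ x‖ₑ ^ 2 ≤ ENNReal.ofReal 1 :=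
    (le_add_self.trans hclose).trans (ENNReal.ofReal_le_ofReal hδ1)
  constructor
  · exact (stab_lintegral_enorm_sq_le_add_sub hu₀.aestronglyMeasurable).trans
      (stab_two_mul_add_le_ofReal h0 hA hC₀ zero_le_one (by linarith))
  · calc ∫⁻ x, ENNReal.ofReal (frobeniusNormSq (fderiv ℝ v₀ x))
        ≤ 3 * ∫⁻ x, ‖fderiv ℝ v₀ x‖ₑ ^ 2 := stab_lintegral_frob_le_three_mul v₀
      _ ≤ 3 * (2 * (∫⁻ x, ‖fderiv ℝ u₀ x‖ₑ ^ 2) +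
            2 * ∫⁻ x, ‖fderiv ℝ v₀ x - fderiv ℝ u₀ x‖ₑ ^ 2) := by
          gcongr
          exact stab_lintegral_enorm_sq_le_add_sub hDu₀.aestronglyMeasurable
      _ ≤ 3 * ENNReal.ofReal (2 * C₁ + 2) := by
          gcongr
          exact stab_two_mul_add_le_ofReal h1 hB hC₁ zero_le_one (by norm_num)
      _ ≤ ENNReal.ofReal (6 * C₁ + 6) := stab_three_mul_le_ofReal le_rfl (by linarith)

/-! ### The stub -/

/-- **Continuous dependence on the datum in `H¹` for Tao's smooth class, from the one-step
recovery and the interpolation** (Tao 2013, Thm. 5.4 (iii)+(v); Robinson–Rodrigo–Sadowski 2016,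
Thms. 6.8–6.10, 8.19): around a Tao-class solution `u` on `[0, T]` there are `δ > 0` and `B` such
that every Tao-class solution `v`, on any sub-slab `[0, T'] ⊆ [0, T]`, from a smooth
divergence-free rapidly decaying datum `δ`-close in `H¹`, has enstrophy `≤ B` throughout.
Time-stepping: with `A = 4 (C₀ + 3 C₁) + 8` (`Cₙ ≥ sup_t ∫‖Dⁿu(t)‖²`) and `σ, S, H` from the step,
induct over the restart times `iσ ≤ T'`: the `H¹` data bound `A` at `iσ` gives enstrophy `≤ S`
on `[iσ, (i+1)σ] ∩ [0, T']` and `∫‖D²v((i+1)σ)‖² ≤ H`; the tree's `L²` stability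
(`exists_l2_stability`, RRS Thm. 6.10) keeps `‖v − u‖²_{L²} ≤ δ exp(C ν⁻³ (3C₁)² T)` on
`[0, T']`, so the interpolation makes `∫|∇(v − u)((i+1)σ)|² ≤ 1` for `δ` small, recovering the
data bound `A` at `(i+1)σ` (energy inequality for the `L²` part). -/
theorem stub_stability_of_step :
    (∀ ν : ℝ, 0 < ν → ∀ A : ℝ, 0 ≤ A → ∃ σ : ℝ, 0 < σ ∧ ∃ S H : ℝ,
      ∀ (T : ℝ) (w₀ : ℝ³ → ℝ³) (w : ℝ → ℝ³ → ℝ³) (q : ℝ → ℝ³ → ℝ), 0 < T → T ≤ σ →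
        IsTaoSolutionOn T ν w₀ w q →
        (∫⁻ x, ‖w₀ x‖ₑ ^ 2) + (∫⁻ x, ENNReal.ofReal (frobeniusNormSq (fderiv ℝ w₀ x))) ≤
          ENNReal.ofReal A →
        (∀ t ∈ Set.Icc 0 T,
            (∫⁻ x, ENNReal.ofReal (frobeniusNormSq (fderiv ℝ (w t) x))) ≤ ENNReal.ofReal S) ∧
          (T = σ → ∫⁻ x, ‖iteratedFDeriv ℝ 2 (w T) x‖ₑ ^ 2 ≤ ENNReal.ofReal H)) →
    (∃ K : ℝ, 0 ≤ K ∧ ∀ f : ℝ³ → ℝ³, ContDiff ℝ 2 f → (∫⁻ x, ‖f x‖ₑ ^ 2) < ⊤ →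
      (∫⁻ x, ‖iteratedFDeriv ℝ 1 f x‖ₑ ^ 2) < ⊤ → (∫⁻ x, ‖iteratedFDeriv ℝ 2 f x‖ₑ ^ 2) < ⊤ →
      (∫⁻ x, ENNReal.ofReal (frobeniusNormSq (fderiv ℝ f x))) ^ 2 ≤
        ENNReal.ofReal K * (∫⁻ x, ‖f x‖ₑ ^ 2) * (∫⁻ x, ‖iteratedFDeriv ℝ 2 f x‖ₑ ^ 2)) →
    ∀ ν : ℝ, 0 < ν → ∀ T : ℝ, 0 < T →
      ∀ (u₀ : ℝ³ → ℝ³) (u : ℝ → ℝ³ → ℝ³) (p : ℝ → ℝ³ → ℝ), IsTaoSolutionOn T ν u₀ u p →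
        ∃ δ : ℝ, 0 < δ ∧ ∃ B : ℝ, ∀ (v₀ : ℝ³ → ℝ³), ContDiff ℝ ∞ v₀ → VectorCalculus.IsDivFree v₀ →
          HasRapidSpatialDecay v₀ →
          (∫⁻ x, ‖v₀ x - u₀ x‖ₑ ^ 2) + (∫⁻ x, ‖fderiv ℝ v₀ x - fderiv ℝ u₀ x‖ₑ ^ 2) ≤
            ENNReal.ofReal δ →
          ∀ (T' : ℝ) (v : ℝ → ℝ³ → ℝ³) (q : ℝ → ℝ³ → ℝ), 0 < T' → T' ≤ T →
            IsTaoSolutionOn T' ν v₀ v q →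
            ∀ t ∈ Set.Icc 0 T', (∫⁻ x, ‖fderiv ℝ (v t) x‖ₑ ^ 2) ≤ ENNReal.ofReal B := by
  intro hstep hinterp ν hν T hT u₀ u p hu
  -- Sobolev constants of the reference solution, as `ofReal` bounds
  obtain ⟨C₀, hC₀⟩ := hu.sobolev 0
  obtain ⟨C₁, hC₁⟩ := hu.sobolev 1
  obtain ⟨C₂, hC₂⟩ := hu.sobolev 2
  have hC₀' : ∀ s ∈ Icc 0 T, ∫⁻ x, ‖u s x‖ₑ ^ 2 ≤ ENNReal.ofReal (C₀ : ℝ) := fun s hs => by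
    rw [stab_lintegral_eq_zero]; exact stab_le_ofReal_coe (hC₀ s hs)
  have hC₁' : ∀ s ∈ Icc 0 T, ∫⁻ x, ‖iteratedFDeriv ℝ 1 (u s) x‖ₑ ^ 2 ≤ ENNReal.ofReal (C₁ : ℝ) :=
    fun s hs => stab_le_ofReal_coe (hC₁ s hs)
  have hC₂' : ∀ s ∈ Icc 0 T, ∫⁻ x, ‖iteratedFDeriv ℝ 2 (u s) x‖ₑ ^ 2 ≤ ENNReal.ofReal (C₂ : ℝ) :=
    fun s hs => stab_le_ofReal_coe (hC₂ s hs)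
  have hT0 : (0 : ℝ) ∈ Icc 0 T := ⟨le_rfl, hT.le⟩
  have hu0 : ContDiff ℝ ∞ u₀ := hu.initial ▸ hu.classical.contDiff_velocity hT0
  have hmemu0 : MemLp u₀ 2 volume := hu.initial ▸ hu.continuousL2.1 0 hT0
  -- the constants
  obtain ⟨A, hA⟩ : ∃ A : ℝ, A = 4 * ((C₀ : ℝ) + 3 * C₁) + 8 := ⟨_, rfl⟩
  have hA0 : 0 ≤ A := by rw [hA]; positivity
  obtain ⟨σ, hσ, S, H, hst⟩ := hstep ν hν A hA0
  obtain ⟨K, hK0, hint⟩ := hinterp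
  obtain ⟨CL, hCL0, hl2⟩ := exists_l2_stability
  obtain ⟨M₁, hM₁⟩ : ∃ M₁ : ℝ, M₁ = Real.exp (CL * (ν ^ 3)⁻¹ * (3 * (C₁ : ℝ)) ^ 2 * T) :=
    ⟨_, rfl⟩
  have hM₁0 : 0 < M₁ := by rw [hM₁]; exact Real.exp_pos _
  obtain ⟨P, hP⟩ : ∃ P : ℝ, P = (K + 1) * M₁ * (2 * max H 0 + 2 * (C₂ : ℝ) + 1) := ⟨_, rfl⟩
  have hP0 : 0 < P := by rw [hP]; positivity
  obtain ⟨δ, hδ⟩ : ∃ δ : ℝ, δ = min 1 (1 / P) := ⟨_, rfl⟩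
  have hδ0 : 0 < δ := by rw [hδ]; exact lt_min one_pos (by positivity)
  have hδ1 : δ ≤ 1 := by rw [hδ]; exact min_le_left _ _
  have hsmall : K * (δ * M₁) * (2 * max H 0 + 2 * (C₂ : ℝ)) ≤ 1 :=
    stab_small hK0 hM₁0 (le_max_right _ _) C₂.coe_nonneg hP hδ0.le (hδ ▸ min_le_right _ _)
  refine ⟨δ, hδ0, max S A, ?_⟩
  intro v₀ _hv₀ _hdiv _hdec hclose T' v q hT'0 hT'T hv t ht
  have hu' : IsTaoSolutionOn T' ν u₀ u p := hu.mono hT'0 hT'T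
  have hIcc : ∀ {s : ℝ}, s ∈ Icc 0 T' → s ∈ Icc 0 T := fun hs => ⟨hs.1, hs.2.trans hT'T⟩
  have hmemv0 : MemLp v₀ 2 volume := hv.initial ▸ hv.continuousL2.1 0 ⟨le_rfl, hT'0.le⟩
  -- the data bound at time `0`
  have hDu0 : ∫⁻ x, ‖fderiv ℝ u₀ x‖ₑ ^ 2 ≤ ENNReal.ofReal (C₁ : ℝ) := by
    rw [stab_lintegral_fderiv_eq_one, ← hu.initial]; exact hC₁' 0 hT0
  obtain ⟨hv0L2, hv0H1⟩ := stab_init hu0.continuous (hu0.continuous_fderiv (by simp))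
    (hu.initial ▸ hC₀' 0 hT0) hDu0 C₀.coe_nonneg C₁.coe_nonneg hδ1 hclose
  -- the energy inequality for `v`
  have hvE : ∀ τ ∈ Icc 0 T', ∫⁻ x, ‖v τ x‖ₑ ^ 2 ≤ ENNReal.ofReal (2 * C₀ + 2) := fun τ hτ =>
    calc ∫⁻ x, ‖v τ x‖ₑ ^ 2 ≤ ENNReal.ofReal (2 * VectorCalculus.kineticEnergy v₀) :=
          hv.lintegral_enorm_sq_le hT'0 hν.le hτ
      _ = ∫⁻ x, ‖v₀ x‖ₑ ^ 2 := (eEnergy_eq_ofReal v₀ hmemv0).symm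
      _ ≤ ENNReal.ofReal (2 * C₀ + 2) := hv0L2
  -- the `L²` stability of the difference on `[0, T']`
  have hSu : ∀ s ∈ Icc 0 T', ∫ x, frobeniusNormSq (fderiv ℝ (u s) x) ≤ 3 * (C₁ : ℝ) :=
    fun s hs => stab_integral_frob_le ((hu.classical.contDiff_velocity (hIcc hs)).of_le
      (by norm_cast)) C₁.coe_nonneg (hC₁' s (hIcc hs))
  have hclose0 : ∫ x, ‖v₀ x - u₀ x‖ ^ 2 ≤ δ :=
    stab_integral_le_of_lintegral_le (hmemv0.sub hmemu0) hδ0.le (le_self_add.trans hclose)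
  have hL2 : ∀ τ ∈ Icc 0 T', ∫⁻ x, ‖v τ x - u τ x‖ₑ ^ 2 ≤ ENNReal.ofReal (δ * M₁) := by
    intro τ hτ
    have h := hl2 hν hT'0 hv.classical hu'.classical hv.sobolev hv.sobolev_dt hv.sobolev_p
      hu'.sobolev hu'.sobolev_dt hu'.sobolev_p hSu τ hτ
    rw [hv.initial, hu.initial] at h
    have hexp : Real.exp (CL * (ν ^ 3)⁻¹ * (3 * (C₁ : ℝ)) ^ 2 * τ) ≤ M₁ := by
      rw [hM₁]
      exact Real.exp_le_exp.2 (mul_le_mul_of_nonneg_left (hIcc hτ).2 (by positivity))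
    exact stab_lintegral_le_of_integral_le
      ((hv.continuousL2.1 τ hτ).sub (hu.continuousL2.1 τ (hIcc hτ)))
      (h.trans (mul_le_mul hclose0 hexp (Real.exp_pos _).le hδ0.le))
  -- the induction over the restart times `iσ ≤ T'`
  have key : ∀ i : ℕ, (i : ℝ) * σ ≤ T' →
      (∫⁻ x, ‖v ((i : ℝ) * σ) x‖ₑ ^ 2) +
        (∫⁻ x, ENNReal.ofReal (frobeniusNormSq (fderiv ℝ (v ((i : ℝ) * σ)) x))) ≤
        ENNReal.ofReal A := by
    intro i
    induction i with
    | zero =>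
      intro _
      rw [Nat.cast_zero, zero_mul, hv.initial]
      exact stab_add_le_ofReal hv0L2 hv0H1 (by positivity) (by positivity)
        (by rw [hA]; nlinarith [C₀.coe_nonneg, C₁.coe_nonneg])
    | succ i ih =>
      intro hle
      push_cast at hle
      have hτeq : ((i : ℝ) + 1) * σ = σ + (i : ℝ) * σ := by ring
      rw [Nat.cast_succ, hτeq]
      set a : ℝ := (i : ℝ) * σ with ha
      have ha0 : 0 ≤ a := by positivity
      have hle' : σ + a ≤ T' := by linarith
      have haT' : a < T' := by linarith
      have hdat := ih (by linarith)
      have hτ : σ + a ∈ Icc 0 T' := ⟨by positivity, hle'⟩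
      -- one full step from the restart time `a`
      have hvi : IsTaoSolutionOn σ ν (v a) (fun s => v (s + a)) (fun s => q (s + a)) :=
        (hv.translate ha0 haT').mono hσ (by linarith)
      have hH2 : ∫⁻ x, ‖iteratedFDeriv ℝ 2 (v (σ + a)) x‖ₑ ^ 2 ≤ ENNReal.ofReal (max H 0) :=
        ((hst σ (v a) (fun s => v (s + a)) (fun s => q (s + a)) hσ le_rfl hvi hdat).2
          rfl).trans (ENNReal.ofReal_le_ofReal (le_max_left _ _))
      -- `D²` of the difference at the new restart time
      have hvs : ContDiff ℝ 2 (v (σ + a)) := (hv.classical.contDiff_velocity hτ).of_le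
        (by norm_cast)
      have hus : ContDiff ℝ 2 (u (σ + a)) := (hu.classical.contDiff_velocity (hIcc hτ)).of_le
        (by norm_cast)
      have hD2 : ∫⁻ x, ‖iteratedFDeriv ℝ 2 (fun y => v (σ + a) y - u (σ + a) y) x‖ₑ ^ 2 ≤
          ENNReal.ofReal (2 * max H 0 + 2 * (C₂ : ℝ)) :=
        (stab_lintegral_iteratedFDeriv_sub_le hvs hus).trans
          (stab_two_mul_add_le_ofReal hH2 (hC₂' _ (hIcc hτ)) (le_max_right _ _)
            C₂.coe_nonneg le_rfl)
      have hv1 : (∫⁻ x, ‖iteratedFDeriv ℝ 1 (v (σ + a)) x‖ₑ ^ 2) < ⊤ := (hv.slice hτ).2.2 1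
      have hfrob := stab_frob_step hK0 hint hvs hus hv1 (hC₁' _ (hIcc hτ)) C₁.coe_nonneg
        (hL2 _ hτ) (by positivity) hD2 hsmall
      exact stab_add_le_ofReal (hvE _ hτ) hfrob (by positivity) (by positivity)
        (by rw [hA]; nlinarith [C₀.coe_nonneg, C₁.coe_nonneg])
  -- conclusion at the given time `t`: restart from `a = ⌊t/σ⌋ σ`
  obtain ⟨i, hia, hib⟩ := stab_floor hσ ht.1
  have hdat := key i (hia.trans ht.2)
  refine (lintegral_mono fun x => enorm_sq_fderiv_le_ofReal_frobeniusNormSq _).trans ?_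
  rcases eq_or_lt_of_le hia with hat | hat
  · rw [← hat]
    exact (le_add_self.trans hdat).trans (ENNReal.ofReal_le_ofReal (le_max_right _ _))
  · have haT' : (i : ℝ) * σ < T' := hat.trans_le ht.2
    have hρ : 0 < min σ (T' - (i : ℝ) * σ) := lt_min hσ (by linarith)
    have hvi : IsTaoSolutionOn (min σ (T' - (i : ℝ) * σ)) ν (v ((i : ℝ) * σ))
        (fun s => v (s + (i : ℝ) * σ)) (fun s => q (s + (i : ℝ) * σ)) :=
      (hv.translate (by positivity) haT').mono hρ (min_le_right _ _)
    have h := (hst _ (v ((i : ℝ) * σ)) _ _ hρ (min_le_left _ _) hvi hdat).1 (t - (i : ℝ) * σ)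
      ⟨by linarith, le_min (by linarith) (by linarith [ht.2])⟩
    have h' : ∫⁻ x, ENNReal.ofReal (frobeniusNormSq (fderiv ℝ (v t) x)) ≤ ENNReal.ofReal S := by
      simpa only [sub_add_cancel] using h
    exact h'.trans (ENNReal.ofReal_le_ofReal (le_max_left _ _))

end Summit.NavierStokesRegularity.NavierStokesRegularity.Theorems.CertifiedBlowupAxisymBlowup.CompactAmplification

end
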